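import Summits.NavierStokesRegularity.NavierStokesRegularity.Theorems.ExtremiserTransienceTwoThirdsGaugeL2Package
import Summits.NavierStokesRegularity.NavierStokesRegularity.Theorems.ExtremiserTransienceTwoThirdsRemainderPointwise
import Literature.Analysis.FluidPDE.BiotSavartHolder
import Literature.Analysis.FluidPDE.LagrangianVelocityTimeDerivative
import HarnessLib

/-!
# Route `ExtremiserTransience`, crux `NearExtremalTransiencePerFlow` (stmt-NavierStokesRegularity-26567),
# LINE g10-1 «two_thirds» (ns-idea-10), stub S1a′ — BRICK 2, lemma P3b: SIZES OF THE PIECE GAUGE AT SCALE `ρ`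

`--supports stmt-NavierStokesRegularity-26567` (helper; prover seat ns-net-p2 g13).  Normalised units (`‖w‖ ≤ 1`, `‖Dw‖ ≤ A₁`, linear growth
`∫_{B(x,r)}‖w‖² ≤ A_E r`).  The piece of `w` in the cell `B(c, ρ⁸)` (layer width `ρ⁷`, S2's parametrisation `R = ρ⁸`, `ℓ = ρ⁷`) is cut out of
the truncated Biot–Savart gauge `ψ = K∗(ζw)`, `ζ = ballCutoff c ρ⁸` (`= 1` on `B̄(c, 2ρ⁸)`, `= 0` off `B(c, 3ρ⁸)`), with curl-free remainder
`G = w − curl ψ` on `B(c, 2ρ⁸)`.  `pieceGauge_sizes` collects, with ONE universal constant `C`, every size of this gauge the excess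
estimate needs:

* `G` is curl free on `B(c, 2ρ⁸)`; `‖G‖ ≤ C(A_E+5)/ρ⁸` and `‖DG‖ ≤ C(A_E+5)/ρ¹⁶` on `B(c, 3ρ⁸/2)` (`gauge_pointwise`, ns-net-p1 p727122);
* `‖ψ‖ ≤ C(A_E+5)·ρ` on `B(c, 2ρ⁸)` (the logarithmic sup bound `1 + (K+1)(A_E+4π/3)/(2π)` with the crude choice `K+1 = 8⌈ρ⌉+3`);
* `‖Dψ‖ ≤ C(A₁+1)·ρ⁴` EVERYWHERE — the Hölder route: `ζw` is `½`-Hölder with constant `A₁ + C₀ + 2` and supported in `B̄(c, 3ρ⁸)`, so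
  Majda–Bertozzi (4.39) (`exists_norm_fderiv_biotSavart_le`, γ = ½) gives `c(γ)((A₁+C₀+2)(3ρ⁸)^{1/2} + 1)`; polynomial growth `ρ⁴` is
  harmless because every pointwise occurrence of `Dψ` in the piece field carries a factor `Dχ = O(ρ⁻⁷)`;
* `∫‖Dψ‖² ≤ C·A_E·ρ⁸`, `∫‖D²ψ‖² ≤ C·(Z_{B(c,4ρ⁸)} + A_E/ρ⁸)` (`gauge_L2`, Calderón–Zygmund at `p = 2`, ns-net-p1 p727402).
HONEST FRAMING: potential-theory bookkeeping; nothing about Navier–Stokes is proved; no summit is proved by a line. [folklore]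
-/

noncomputable section

open scoped Topology InnerProductSpace RealInnerProductSpace ENNReal NNReal ContDiff
open MeasureTheory Filter Set Metric
open Literature.Analysis.FluidPDE
open Summit.NavierStokesRegularity.NavierStokesRegularity.Theorems.DepletionLadder.KStar.HalfSpace
open Summit.NavierStokesRegularity.NavierStokesRegularity.Theorems.NearExtremalTransiencePerFlow.LocalMaximiser

namespace Summit.NavierStokesRegularity.NavierStokesRegularity.Theorems.NearExtremalTransiencePerFlow.TwoThirds

-- the summit's namespace repeats the problem name by convention (D-0017)
set_option linter.dupNamespace false

/-- The dyadic depth of the cell: `5ρ⁸ ≤ 2^{8⌈ρ⌉+3}` and `8⌈ρ⌉ + 3 ≤ 14ρ` for `ρ ≥ 2`. [folklore] -/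
theorem dyadicDepth_bounds {ρ : ℝ} (hρ : 2 ≤ ρ) :
    5 * ρ ^ 8 ≤ (2 : ℝ) ^ (8 * ⌈ρ⌉₊ + 2 + 1) ∧ ((8 * ⌈ρ⌉₊ + 2 : ℕ) : ℝ) + 1 ≤ 14 * ρ := by
  have hρ0 : 0 ≤ ρ := by linarith
  have hn : ρ ≤ (⌈ρ⌉₊ : ℝ) := Nat.le_ceil ρ
  have hn2 : ((⌈ρ⌉₊ : ℕ) : ℝ) ≤ (2 : ℝ) ^ ⌈ρ⌉₊ := by exact_mod_cast (Nat.lt_two_pow_self).le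
  have hρ2 : ρ ≤ (2 : ℝ) ^ ⌈ρ⌉₊ := hn.trans hn2
  have h8 : ρ ^ 8 ≤ ((2 : ℝ) ^ ⌈ρ⌉₊) ^ 8 := pow_le_pow_left₀ hρ0 hρ2 8
  have hceil : ((⌈ρ⌉₊ : ℕ) : ℝ) < ρ + 1 := Nat.ceil_lt_add_one hρ0
  constructor
  · rw [show 8 * ⌈ρ⌉₊ + 2 + 1 = 8 * ⌈ρ⌉₊ + 3 by ring, pow_add, pow_mul']
    calc 5 * ρ ^ 8 ≤ 8 * ρ ^ 8 := by nlinarith [pow_nonneg hρ0 8]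
      _ ≤ 8 * ((2 : ℝ) ^ ⌈ρ⌉₊) ^ 8 := by linarith
      _ = ((2 : ℝ) ^ ⌈ρ⌉₊) ^ 8 * 2 ^ 3 := by ring
  · push_cast
    linarith

set_option maxHeartbeats 400000 in
/-- **SIZES OF THE PIECE GAUGE AT SCALE `ρ`** (see the module docstring). [folklore] -/
theorem pieceGauge_sizes : ∃ C : ℝ, 0 ≤ C ∧ ∀ (w : E3 → E3) (A₁ A_E : ℝ) (c : E3) (ρ : ℝ),
    ContDiff ℝ (⊤ : ℕ∞) w → VectorCalculus.IsDivFree w → (∀ x, ‖w x‖ ≤ 1) → (∀ x, ‖fderiv ℝ w x‖ ≤ A₁) → 0 ≤ A₁ →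
    HasLinearGrowth A_E w → 0 ≤ A_E → 2 ≤ ρ →
    ContDiff ℝ (⊤ : ℕ∞) (biotSavart fun y => ballCutoff c (ρ ^ 8) y • w y) ∧
    ContDiff ℝ (⊤ : ℕ∞) (fun x => w x - curl (biotSavart fun y => ballCutoff c (ρ ^ 8) y • w y) x) ∧
    (∀ x ∈ ball c (2 * ρ ^ 8), curl (fun x => w x - curl (biotSavart fun y => ballCutoff c (ρ ^ 8) y • w y) x) x = 0) ∧
    (∀ x ∈ ball c (3 / 2 * ρ ^ 8), ‖w x - curl (biotSavart fun y => ballCutoff c (ρ ^ 8) y • w y) x‖ ≤ C * (A_E + 5) / ρ ^ 8) ∧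
    (∀ x ∈ ball c (3 / 2 * ρ ^ 8),
      ‖fderiv ℝ (fun x => w x - curl (biotSavart fun y => ballCutoff c (ρ ^ 8) y • w y) x) x‖ ≤ C * (A_E + 5) / ρ ^ 16) ∧
    (∀ x ∈ ball c (2 * ρ ^ 8), ‖biotSavart (fun y => ballCutoff c (ρ ^ 8) y • w y) x‖ ≤ C * (A_E + 5) * ρ) ∧
    (∀ x, ‖fderiv ℝ (biotSavart fun y => ballCutoff c (ρ ^ 8) y • w y) x‖ ≤ C * (A₁ + 1) * ρ ^ 4) ∧
    Integrable (fun x => ‖fderiv ℝ (biotSavart fun y => ballCutoff c (ρ ^ 8) y • w y) x‖ ^ 2) ∧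
    (∫ x, ‖fderiv ℝ (biotSavart fun y => ballCutoff c (ρ ^ 8) y • w y) x‖ ^ 2 ≤ C * A_E * ρ ^ 8) ∧
    Integrable (fun x => ‖iteratedFDeriv ℝ 2 (biotSavart fun y => ballCutoff c (ρ ^ 8) y • w y) x‖ ^ 2) ∧
    (∫ x, ‖iteratedFDeriv ℝ 2 (biotSavart fun y => ballCutoff c (ρ ^ 8) y • w y) x‖ ^ 2 ≤
      C * (Zb w c (4 * ρ ^ 8) + A_E / ρ ^ 8)) := by
  obtain ⟨C₀, hC₀0, hC₀⟩ := exists_norm_fderiv_ballCutoff_le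
  obtain ⟨CL, hCL0, hCL⟩ := gauge_L2
  obtain ⟨cH, hcH0, hcH⟩ := exists_norm_fderiv_biotSavart_le (γ := (1 / 2 : ℝ≥0)) (by norm_num)
  refine ⟨64 * C₀ / Real.pi + 3 + cH * (2 * C₀ + 5) + CL + CL ^ 2 * (1 + C₀ ^ 2), by positivity, ?_⟩
  intro w A₁ A_E c ρ hw hdiv hw1 hDw hA₁ hgr hAE hρ
  set C : ℝ := 64 * C₀ / Real.pi + 3 + cH * (2 * C₀ + 5) + CL + CL ^ 2 * (1 + C₀ ^ 2) with hC
  have hπ : 0 < Real.pi := Real.pi_pos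
  have hπ3 : 3 ≤ Real.pi := by linarith [Real.pi_gt_three]
  have n1 : 0 ≤ 64 * C₀ / Real.pi := by positivity
  have n3 : 0 ≤ cH * (2 * C₀ + 5) := by positivity
  have n5 : 0 ≤ CL ^ 2 * (1 + C₀ ^ 2) := by positivity
  have hC1 : 64 * C₀ / Real.pi ≤ C := by rw [hC]; linarith
  have hC2 : (3 : ℝ) ≤ C := by rw [hC]; linarith
  have hC3 : cH * (2 * C₀ + 5) ≤ C := by rw [hC]; linarith
  have hC4 : CL ≤ C := by rw [hC]; linarith
  have hC5 : CL ^ 2 * (1 + C₀ ^ 2) ≤ C := by rw [hC]; linarith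
  have hC0 : 0 ≤ C := le_trans (by norm_num) hC2
  have hρ0 : 0 < ρ := by linarith
  have hρ1 : 1 ≤ ρ := by linarith
  have hR0 : 0 < ρ ^ 8 := by positivity
  have hR1 : 1 ≤ ρ ^ 8 := one_le_pow₀ hρ1
  have hC₀R : ∀ y, ‖fderiv ℝ (ballCutoff c (ρ ^ 8)) y‖ ≤ C₀ / ρ ^ 8 := hC₀ c (ρ ^ 8) hR0
  have hAE5 : A_E + 4 * Real.pi / 3 ≤ A_E + 5 := by linarith [Real.pi_lt_d2]
  have hAE0' : 0 ≤ A_E + 4 * Real.pi / 3 := by linarith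
  have hAE50 : 0 ≤ A_E + 5 := by linarith
  -- ns-net-p1's pointwise package
  obtain ⟨hψs, hGs, hG0, hGle, hDGle, hψle⟩ := gauge_pointwise (c := c) hw hdiv hw1 hgr hAE hR0 hC₀0 hC₀R
  obtain ⟨hh, hhc, hh1, -, -, hhsupp, -⟩ := truncation_facts (c := c) hw hdiv hw1 hR0 hC₀R
  -- ns-net-p1's `L²` package
  obtain ⟨iDψ, hDψ, -, hDh, iD2ψ, hD2ψ⟩ := hCL w A_E c (ρ ^ 8) C₀ hw hdiv hw1 hgr hAE hR0 hC₀0 hC₀R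
  refine ⟨hψs, hGs, hG0, fun x hx => ?_, fun x hx => ?_, fun x hx => ?_, fun x => ?_, iDψ, ?_, iD2ψ, ?_⟩
  · -- `‖G‖ ≤ 8C₀(A_E+4π/3)/(πR)`
    refine (hGle x hx).trans ?_
    have e : (Real.pi * (ρ ^ 8) ^ 2)⁻¹ * (8 * C₀ * (A_E + 4 * Real.pi / 3) * ρ ^ 8) =
        8 * C₀ / Real.pi * (A_E + 4 * Real.pi / 3) / ρ ^ 8 := by
      field_simp
    rw [e, div_le_div_iff_of_pos_right hR0]
    have h1 : 8 * C₀ / Real.pi * (A_E + 4 * Real.pi / 3) ≤ 64 * C₀ / Real.pi * (A_E + 5) := by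
      have h8 : 8 * C₀ / Real.pi ≤ 64 * C₀ / Real.pi := by
        rw [div_le_div_iff_of_pos_right hπ]; nlinarith
      exact mul_le_mul h8 hAE5 hAE0' n1
    exact h1.trans (mul_le_mul_of_nonneg_right hC1 hAE50)
  · -- `‖DG‖ ≤ 64C₀(A_E+4π/3)/(πR²)`
    refine (hDGle x hx).trans ?_
    have e : 8 / (Real.pi * (ρ ^ 8) ^ 3) * (8 * C₀ * (A_E + 4 * Real.pi / 3) * ρ ^ 8) =
        64 * C₀ / Real.pi * (A_E + 4 * Real.pi / 3) / ρ ^ 16 := by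
      field_simp
      ring
    rw [e, div_le_div_iff_of_pos_right (by positivity)]
    exact (mul_le_mul_of_nonneg_left hAE5 n1).trans (mul_le_mul_of_nonneg_right hC1 hAE50)
  · -- `‖ψ‖ ≤ 1 + (K+1)(A_E+4π/3)/(2π)` with `K + 1 = 8⌈ρ⌉ + 3 ≤ 14ρ`
    obtain ⟨hK, hK'⟩ := dyadicDepth_bounds hρ
    have h := hψle (8 * ⌈ρ⌉₊ + 2) x hx hK
    refine h.trans ?_
    have h14 : ((8 * ⌈ρ⌉₊ + 2 : ℕ) : ℝ) + 1 ≤ 14 * ρ := hK'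
    have hρAE : 10 ≤ ρ * (A_E + 5) := by nlinarith
    have hY0 : 0 ≤ 14 * ρ * (A_E + 5) := by positivity
    have hnum : (((8 * ⌈ρ⌉₊ + 2 : ℕ) : ℝ) + 1) * (A_E + 4 * Real.pi / 3) ≤ 14 * ρ * (A_E + 5) :=
      mul_le_mul h14 hAE5 hAE0' (by linarith)
    have hfrac : (((8 * ⌈ρ⌉₊ + 2 : ℕ) : ℝ) + 1) * (A_E + 4 * Real.pi / 3) / (2 * Real.pi) ≤ 14 * ρ * (A_E + 5) / 6 := by
      rw [div_le_div_iff₀ (by positivity) (by norm_num)]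
      nlinarith [hnum, mul_nonneg hY0 (by linarith : (0:ℝ) ≤ 2 * Real.pi - 6)]
    have h3C : 3 * (A_E + 5) * ρ ≤ C * (A_E + 5) * ρ :=
      mul_le_mul_of_nonneg_right (mul_le_mul_of_nonneg_right hC2 hAE50) hρ0.le
    linarith
  · -- `‖Dψ‖ ≤ c(½)((A₁+C₀+2)(3R)^{1/2} + 1)` by the Hölder route
    have hζs : ContDiff ℝ (⊤ : ℕ∞) (ballCutoff c (ρ ^ 8)) := contDiff_ballCutoff c (ρ ^ 8)
    have hhd : Differentiable ℝ (fun y => ballCutoff c (ρ ^ 8) y • w y) := hh.differentiable (by simp)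
    have hDh_pt : ∀ y, ‖fderiv ℝ (fun y => ballCutoff c (ρ ^ 8) y • w y) y‖ ≤ A₁ + C₀ := by
      intro y
      refine (norm_fderiv_smul_le hζs hw y).trans ?_
      have h1 : |ballCutoff c (ρ ^ 8) y| * ‖fderiv ℝ w y‖ ≤ 1 * A₁ :=
        mul_le_mul (abs_ballCutoff_le_one c (ρ ^ 8) y) (hDw y) (norm_nonneg _) zero_le_one
      have h2 : ‖fderiv ℝ (ballCutoff c (ρ ^ 8)) y‖ * ‖w y‖ ≤ C₀ / ρ ^ 8 * 1 :=
        mul_le_mul (hC₀R y) (hw1 y) (norm_nonneg _) (div_nonneg hC₀0 hR0.le)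
      have h3 : C₀ / ρ ^ 8 ≤ C₀ := div_le_self hC₀0 hR1
      linarith
    have hK₀ : ∀ y, ‖fderiv ℝ (fun y => ballCutoff c (ρ ^ 8) y • w y) y‖₊ ≤ Real.toNNReal (A₁ + C₀) := by
      intro y
      rw [← NNReal.coe_le_coe, coe_nnnorm, Real.coe_toNNReal _ (by positivity)]
      exact hDh_pt y
    have hLip : LipschitzWith (Real.toNNReal (A₁ + C₀)) (fun y => ballCutoff c (ρ ^ 8) y • w y) := lipschitzWith_of_nnnorm_fderiv_le hhd hK₀
    have hHol : HolderWith (Real.toNNReal (A₁ + C₀) + Real.toNNReal (2 * 1)) (1 / 2 : ℝ≥0) (fun y => ballCutoff c (ρ ^ 8) y • w y) :=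
      holderWith_of_lipschitzWith_of_norm_le (by norm_num) hLip hh1
    have hsupp : tsupport (fun y => ballCutoff c (ρ ^ 8) y • w y) ⊆ closedBall c (3 * ρ ^ 8) := by
      refine closure_minimal (fun y hy => ?_) isClosed_closedBall
      rw [mem_closedBall, dist_eq_norm]
      exact (hhsupp y hy).le
    have hb := hcH (fun y => ballCutoff c (ρ ^ 8) y • w y) _ c (3 * ρ ^ 8) 1 (by positivity) hHol hsupp hh1 x
    refine hb.trans ?_
    have hcoe : ((Real.toNNReal (A₁ + C₀) + Real.toNNReal (2 * 1) : ℝ≥0) : ℝ) = A₁ + C₀ + 2 := by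
      rw [NNReal.coe_add, Real.coe_toNNReal _ (by positivity), Real.coe_toNNReal _ (by norm_num)]; ring
    have hγ : ((1 / 2 : ℝ≥0) : ℝ) = 1 / 2 := by norm_num
    rw [hcoe, hγ]
    have h34 : 3 * ρ ^ 8 ≤ (2 * ρ ^ 4) ^ 2 := by nlinarith [pow_nonneg hρ0.le 8]
    have hsq : (3 * ρ ^ 8) ^ (1 / 2 : ℝ) ≤ 2 * ρ ^ 4 := by
      rw [← Real.sqrt_eq_rpow]
      calc Real.sqrt (3 * ρ ^ 8) ≤ Real.sqrt ((2 * ρ ^ 4) ^ 2) := Real.sqrt_le_sqrt h34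
        _ = 2 * ρ ^ 4 := Real.sqrt_sq (by positivity)
    have hρ4 : 1 ≤ ρ ^ 4 := one_le_pow₀ hρ1
    have hρ40 : 0 ≤ ρ ^ 4 := by positivity
    have t : (A₁ + C₀ + 2) * (3 * ρ ^ 8) ^ (1 / 2 : ℝ) ≤ (A₁ + C₀ + 2) * (2 * ρ ^ 4) :=
      mul_le_mul_of_nonneg_left hsq (by linarith)
    have aux : (A₁ + C₀ + 2) * (2 * ρ ^ 4) + 1 ≤ (2 * C₀ + 5) * (A₁ + 1) * ρ ^ 4 := by
      nlinarith only [hρ4, hC₀0, hA₁, hρ40, mul_nonneg (mul_nonneg hC₀0 hA₁) hρ40, mul_nonneg hA₁ hρ40]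
    have hin : (A₁ + C₀ + 2) * (3 * ρ ^ 8) ^ (1 / 2 : ℝ) + 1 ≤ (2 * C₀ + 5) * (A₁ + 1) * ρ ^ 4 := by
      linarith only [t, aux]
    have hA10 : 0 ≤ (A₁ + 1) * ρ ^ 4 := mul_nonneg (by linarith) hρ40
    calc cH * ((A₁ + C₀ + 2) * (3 * ρ ^ 8) ^ (1 / 2 : ℝ) + 1)
        ≤ cH * ((2 * C₀ + 5) * (A₁ + 1) * ρ ^ 4) := mul_le_mul_of_nonneg_left hin hcH0
      _ = (cH * (2 * C₀ + 5)) * ((A₁ + 1) * ρ ^ 4) := by ring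
      _ ≤ C * ((A₁ + 1) * ρ ^ 4) := mul_le_mul_of_nonneg_right hC3 hA10
      _ = C * (A₁ + 1) * ρ ^ 4 := by ring
  · -- `∫‖Dψ‖² ≤ CL·A_E·R`
    exact hDψ.trans (mul_le_mul_of_nonneg_right (mul_le_mul_of_nonneg_right hC4 hAE) hR0.le)
  · -- `∫‖D²ψ‖² ≤ CL·∫‖Dh‖² ≤ CL²(Z_{B(c,4R)} + C₀²A_E/R)`
    have hZ0 : 0 ≤ Zb w c (4 * ρ ^ 8) := Zb_nonneg w c (4 * ρ ^ 8)
    have hq0 : 0 ≤ A_E / ρ ^ 8 := div_nonneg hAE hR0.le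
    have inner : Zb w c (4 * ρ ^ 8) + C₀ ^ 2 * A_E / ρ ^ 8 ≤ (1 + C₀ ^ 2) * (Zb w c (4 * ρ ^ 8) + A_E / ρ ^ 8) := by
      rw [mul_div_assoc]
      nlinarith only [mul_nonneg (sq_nonneg C₀) hZ0, hq0]
    have hY0 : 0 ≤ Zb w c (4 * ρ ^ 8) + A_E / ρ ^ 8 := add_nonneg hZ0 hq0
    calc ∫ x, ‖iteratedFDeriv ℝ 2 (biotSavart fun y => ballCutoff c (ρ ^ 8) y • w y) x‖ ^ 2
        ≤ CL * ∫ y, ‖fderiv ℝ (fun y => ballCutoff c (ρ ^ 8) y • w y) y‖ ^ 2 := hD2ψ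
      _ ≤ CL * (CL * (Zb w c (4 * ρ ^ 8) + C₀ ^ 2 * A_E / ρ ^ 8)) := mul_le_mul_of_nonneg_left hDh hCL0
      _ ≤ CL * (CL * ((1 + C₀ ^ 2) * (Zb w c (4 * ρ ^ 8) + A_E / ρ ^ 8))) :=
          mul_le_mul_of_nonneg_left (mul_le_mul_of_nonneg_left inner hCL0) hCL0
      _ = CL ^ 2 * (1 + C₀ ^ 2) * (Zb w c (4 * ρ ^ 8) + A_E / ρ ^ 8) := by ring
      _ ≤ C * (Zb w c (4 * ρ ^ 8) + A_E / ρ ^ 8) := mul_le_mul_of_nonneg_right hC5 hY0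

end Summit.NavierStokesRegularity.NavierStokesRegularity.Theorems.NearExtremalTransiencePerFlow.TwoThirds

end
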